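import Literature.NumberTheory.LFunctions.TwistedSecondMomentPrimeModulus
import Mathlib.Analysis.Calculus.ContDiff.Defs
import HarnessLib

/-!
# The twisted second moment of Dirichlet `L`-functions averaged over the modulus, with twists of
# length `Q^ϑ` for every `ϑ < 1` (Conrey–Iwaniec–Soundararajan 2019, Theorem 1)

Topic `Literature/NumberTheory/LFunctions` (namespace `Literature.NumberTheory.LFunctions`,
sub-namespace `CIS2019`). STATEMENT LAYER (D-0014: sorry-free named `Prop` fact, nothing asserted),
typed for sub-cell C (literature harvest) of the cell `landau-siegel` (rung F-S3; HOME/lit/r1/ROWS.md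
row r1-T01, design family B-len «long mollifiers with asymptotic-large-sieve input»). It is the
`q`-AVERAGED companion of the one-prime-modulus fact
`Literature.NumberTheory.LFunctions.buiPrattRoblesZaharescu2020_theorem11` (length `q^κ`,
`κ < 1/2 + 1/202`): when the modulus is also averaged over `q ∈ [Q, 2Q]` (ALL moduli, smooth weight),
the twisting Dirichlet polynomial may have length `Q^ϑ` for EVERY `ϑ < 1` — twice the
individual-modulus range and exactly up to (never beyond) the length of the conductor. A theorem in
print, typed as a named fact; not a conjecture and not a claim about Landau–Siegel zeros or about the
manuscript arXiv:2211.02515.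

## What the source prints (arXiv:1808.02879 = Funct. Approx. Comment. Math. 61 (2019) 147–177,
## TeX source read 2026-08-26, §1)

"Let `χ mod q` be an even primitive character … The completed `L`-function
`Λ(1/2 + s, χ) = (q/π)^{s/2} Γ(1/4 + s/2) L(1/2 + s, χ)` (1.3) satisfies the functional equation
`Λ(1/2+s) = ε(χ) Λ(1/2−s, χ̄)` (1.4). Let `W` denote a fixed `C^∞` function, compactly supported on
`[1, 2]`, and let `α` and `β` be “shifts.” Our goal is to evaluate
`Δ_{α,β}(h,k;Q) := Σ_q W(q/Q) Σ♭_{χ mod q} Λ(1/2+α, χ) Λ(1/2+β, χ̄) χ(h) χ̄(k)` (1.5),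
where the `♭` indicates that the sum is restricted to even primitive characters. … Our interest is in
the situation where the shifts `α` and `β` are small, (precisely, `α, β ≪ 1/log Q`) …

**Theorem 1.** Let `Q` be large, and suppose the shifts `α` and `β` are `≪ 1/log Q`. Then
`Δ_{α,β}(h,k) = Σ_{(q,hk)=1} W(q/Q) (Σ♭_{χ mod q} 1) ·`
`  ( (q/π)^{(α+β)/2} Γ(1/4+α/2) Γ(1/4+β/2) (h,k)^{1+α+β} / (h^{1/2+β} k^{1/2+α}) · ζ_q(1+α+β)`
`  + (q/π)^{−(α+β)/2} Γ(1/4−α/2) Γ(1/4−β/2) (h,k)^{1−α−β} / (h^{1/2−α} k^{1/2−β}) · ζ_q(1−α−β) )`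
`  + 𝓔_{h,k}`,
where `ζ_q(s) = ζ(s) Π_{p | q} (1 − p^{−s})`, and the remainder terms `𝓔_{h,k}` satisfy
`Σ_{h,k ≤ Q^ϑ} λ_h λ̄_k 𝓔_{h,k} / √(hk) = O(Q^{2 − (1−ϑ)/2 + ε})`,
uniformly for arbitrary complex numbers `λ_h` with `λ_h ≪ h^ε`, and `ϑ < 1`.

In the statement of the theorem, and throughout the paper, `ε` will stand for an positive number that
may be taken arbitrarily small … Thus, in the remainder terms in Theorem 1 we have obtained a power
saving whenever `ϑ` is fixed below `1`." (§2, first sentence: "Throughout, we shall assume that the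
shifts `α` and `β` are non-zero, and `α ≠ ±β`; the final answers will be uniformly continuous in `α`
and `β`, so that the results will hold in the edge cases.") The paper also STATES (without proof; the
proof is K. Sono, J. Number Theory 2025, arXiv:2105.07422, with `0.6107`) the consequence
`Σ_q W(q/Q) Σ♭_χ N₀(T,χ) > (3/5) Σ_q W(q/Q) Σ♭_χ N(T,χ)` for `(log Q)^6 ≤ T ≤ (log Q)^A`; that
corollary is NOT typed here.

## Lean rendering / design choices

* Moduli. `W(q/Q) = 0` unless `Q ≤ q ≤ 2Q`, so the `q`-sum is finite; as in
  `Literature.NumberTheory.LFunctions.OneLevelDensity.primitiveFamilySum` it is written over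
  `q = n + 1 ≤ 3⌈Q⌉` so that `[NeZero q]` is automatic. "Even primitive" = Mathlib
  `χ.IsPrimitive ∧ χ.Even` (the finset of `BPRZ2020.evenPrimitiveCount`). `χ̄ = χ⁻¹` (for unit
  arguments the values are roots of unity, for non-units both sides vanish), so
  `Λ(1/2+β, χ̄) χ̄(k) = Λ(1/2+β, χ⁻¹) χ⁻¹(k)`.
* `Λ(1/2 + s, χ) := (q/π)^{s/2} Γ(1/4 + s/2) L(1/2 + s, χ)` verbatim (complex power of the positive
  real `q/π`), `L` = Mathlib's `DirichletCharacter.LFunction`.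
* `ζ_q(s) = ζ(s) Π_{p ∣ q}(1 − p^{−s})` with Mathlib `riemannZeta` and `Nat.primeFactors`;
  `(h,k)` = `Nat.gcd h k`; powers `x^{w}` of positive integers / reals as complex `cpow`.
* The `≪`-conventions are rendered exactly as in the BPRZ2020 file: the shift-box constant `C₁`
  (`‖α‖, ‖β‖ ≤ C₁ / log Q`) and a coefficient growth budget `C : ℝ → ℝ`
  (`BPRZ2020.DivisorBounded C λ`: `‖λ_h‖ ≤ C(ε') h^{ε'}` for every `ε' > 0`) are fixed FIRST, together
  with `W`, `ϑ` and the target exponent `ε > 0`; THEN the `O`-constant `K` and the threshold `Q₀` may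
  depend on all of these — the uniformity the printed proof delivers ("uniformly for arbitrary …
  `λ_h ≪ h^ε`, and `ϑ < 1`", constants depending on `ε`, `ϑ`, `W`).
* The two main terms have simple poles on `α + β = 0` which cancel (the source works with
  `α ≠ ±β` and passes to the limit); since Mathlib's `riemannZeta 1` is a finite junk value the fact
  is stated for `α + β ≠ 0`, where Theorem 1 is literally meaningful — the printed statement on the
  line `α + β = 0` is the (uniform) limit of these, exactly as for
  `buiPrattRoblesZaharescu2020_theorem11`.
* `0 < ϑ` is assumed (for `ϑ ≤ 0` the twist sum is empty or trivial); `W` real-valued, smooth, with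
  `tsupport W ⊆ [1, 2]` ("compactly supported on `[1,2]`").
No instances, no notation; imports the BPRZ2020 vocabulary file (for `DivisorBounded`,
`evenPrimitiveCount`) and Mathlib only. PROVED here (bookkeeping only): the saving exponent
`2 − (1−ϑ)/2` is `< 2` iff `ϑ < 1` (`CIS2019.savingExponent_lt_two_iff`) — the knife edge `ϑ = 1` of
the printed error term `Q^{2+ε}/C + C Q^{1+ϑ+ε}`, `C = Q^{(1−ϑ)/2}` (end of §9 of the source).

## References

* [ConreyIwaniecSoundararajan2019MeanSquare] §1, (1.3)–(1.5), Theorem 1; §2 first paragraph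
  (edge cases in the shifts); §9 last display (choice `C = Q^{(1−ϑ)/2}`).
* [BuiPrattRoblesZaharescu2020] Theorem 1.1 — the one-prime-modulus companion (typed:
  `TwistedSecondMomentPrimeModulus.lean`), whose `DivisorBounded` budget convention is reused.
-/

noncomputable section

open Finset
open scoped ContDiff

namespace Literature.NumberTheory.LFunctions

namespace CIS2019

/-- The completed `L`-function at `1/2 + s` for an even character `χ` mod `q`:
`Λ(1/2 + s, χ) = (q/π)^{s/2} Γ(1/4 + s/2) L(1/2 + s, χ)` (source (1.3)).
[cite: ConreyIwaniecSoundararajan2019MeanSquare, §1 (1.3)] -/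
def completedLHalf {q : ℕ} [NeZero q] (χ : DirichletCharacter ℂ q) (s : ℂ) : ℂ :=
  (((q : ℂ) / (Real.pi : ℂ)) ^ (s / 2)) * Complex.Gamma (1 / 4 + s / 2) * χ.LFunction (1 / 2 + s)

open scoped Classical in
/-- The inner sum of (1.5) for ONE modulus `q`:
`Σ♭_{χ mod q} Λ(1/2+α, χ) Λ(1/2+β, χ̄) χ(h) χ̄(k)` over even primitive characters (`χ̄ = χ⁻¹`).
[cite: ConreyIwaniecSoundararajan2019MeanSquare, §1 (1.5)] -/
def twistedSumMod (q : ℕ) [NeZero q] (α β : ℂ) (h k : ℕ) : ℂ :=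
  ∑ χ : DirichletCharacter ℂ q with (χ.IsPrimitive ∧ χ.Even),
    completedLHalf χ α * completedLHalf χ⁻¹ β * χ (h : ZMod q) * χ⁻¹ (k : ZMod q)

/-- `Δ_{α,β}(h,k;Q) = Σ_q W(q/Q) Σ♭_{χ mod q} Λ(1/2+α,χ) Λ(1/2+β,χ̄) χ(h) χ̄(k)` (source (1.5)); the
`q`-sum is finite because `W` is supported in `[1,2]` and is written over `q = n + 1 ≤ 3⌈Q⌉`.
[cite: ConreyIwaniecSoundararajan2019MeanSquare, §1 (1.5)] -/
def Delta (W : ℝ → ℝ) (Q : ℝ) (α β : ℂ) (h k : ℕ) : ℂ :=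
  ∑ n ∈ Finset.range (3 * ⌈Q⌉₊),
    ((W (((n + 1 : ℕ) : ℝ) / Q) : ℝ) : ℂ) * twistedSumMod (n + 1) α β h k

/-- `ζ_q(s) = ζ(s) · Π_{p ∣ q} (1 − p^{−s})` (the Riemann zeta function with the Euler factors at the
primes dividing `q` removed). [cite: ConreyIwaniecSoundararajan2019MeanSquare, Theorem 1] -/
def zetaRemoved (q : ℕ) (s : ℂ) : ℂ :=
  riemannZeta s * ∏ p ∈ q.primeFactors, (1 - (p : ℂ) ^ (-s))

/-- The bracket of Theorem 1 for one modulus `q` coprime to `hk`: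
`(q/π)^{(α+β)/2} Γ(1/4+α/2) Γ(1/4+β/2) (h,k)^{1+α+β}/(h^{1/2+β} k^{1/2+α}) ζ_q(1+α+β)`
`+ (q/π)^{−(α+β)/2} Γ(1/4−α/2) Γ(1/4−β/2) (h,k)^{1−α−β}/(h^{1/2−α} k^{1/2−β}) ζ_q(1−α−β)`.
[cite: ConreyIwaniecSoundararajan2019MeanSquare, Theorem 1] -/
def mainBracket (q : ℕ) (α β : ℂ) (h k : ℕ) : ℂ :=
  ((q : ℂ) / (Real.pi : ℂ)) ^ ((α + β) / 2) * Complex.Gamma (1 / 4 + α / 2) *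
        Complex.Gamma (1 / 4 + β / 2) *
      (((Nat.gcd h k : ℕ) : ℂ) ^ (1 + α + β) / ((h : ℂ) ^ (1 / 2 + β) * (k : ℂ) ^ (1 / 2 + α))) *
      zetaRemoved q (1 + α + β) +
    ((q : ℂ) / (Real.pi : ℂ)) ^ (-(α + β) / 2) * Complex.Gamma (1 / 4 - α / 2) *
        Complex.Gamma (1 / 4 - β / 2) *
      (((Nat.gcd h k : ℕ) : ℂ) ^ (1 - α - β) / ((h : ℂ) ^ (1 / 2 - α) * (k : ℂ) ^ (1 / 2 - β))) *
      zetaRemoved q (1 - α - β)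

/-- The main term of Theorem 1:
`Σ_{(q,hk)=1} W(q/Q) (Σ♭_{χ mod q} 1) · mainBracket q α β h k`, with `Σ♭ 1` = the number of even
primitive characters mod `q` (`BPRZ2020.evenPrimitiveCount q`) and the same finite `q`-range as `Delta`.
[cite: ConreyIwaniecSoundararajan2019MeanSquare, Theorem 1] -/
def mainTerm (W : ℝ → ℝ) (Q : ℝ) (α β : ℂ) (h k : ℕ) : ℂ :=
  ∑ n ∈ Finset.range (3 * ⌈Q⌉₊),
    if Nat.Coprime (n + 1) (h * k) then
      ((W (((n + 1 : ℕ) : ℝ) / Q) : ℝ) : ℂ) * (BPRZ2020.evenPrimitiveCount (n + 1) : ℂ) *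
        mainBracket (n + 1) α β h k
    else 0

/-- The remainder term `𝓔_{h,k} = Δ_{α,β}(h,k;Q) − (main term)` of Theorem 1.
[cite: ConreyIwaniecSoundararajan2019MeanSquare, Theorem 1] -/
def remainder (W : ℝ → ℝ) (Q : ℝ) (α β : ℂ) (h k : ℕ) : ℂ :=
  Delta W Q α β h k - mainTerm W Q α β h k

/-- The bilinear average of the remainders against twist coefficients `λ` of length `L`:
`Σ_{h,k ≤ L} λ_h conj(λ_k) 𝓔_{h,k} / √(hk)`.
[cite: ConreyIwaniecSoundararajan2019MeanSquare, Theorem 1] -/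
def remainderForm (W : ℝ → ℝ) (Q : ℝ) (α β : ℂ) (L : ℕ) (coef : ℕ → ℂ) : ℂ :=
  ∑ h ∈ Icc 1 L, ∑ k ∈ Icc 1 L,
    coef h * (starRingEnd ℂ) (coef k) * remainder W Q α β h k /
      ((Real.sqrt ((h : ℝ) * (k : ℝ)) : ℝ) : ℂ)

/-- The saving exponent `2 − (1 − ϑ)/2` of Theorem 1's error term `O(Q^{2 − (1−ϑ)/2 + ε})`.
[cite: ConreyIwaniecSoundararajan2019MeanSquare, Theorem 1] -/
def savingExponent (ϑ : ℝ) : ℝ := 2 - (1 - ϑ) / 2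

/-- The knife edge of the printed error term: the exponent `2 − (1−ϑ)/2` is a genuine power saving
against the main terms of size `≍ Q²` exactly when `ϑ < 1` ("a power saving whenever `ϑ` is fixed
below `1`"). [cite: ConreyIwaniecSoundararajan2019MeanSquare, remark after Theorem 1] -/
theorem savingExponent_lt_two_iff (ϑ : ℝ) : savingExponent ϑ < 2 ↔ ϑ < 1 := by
  unfold savingExponent
  constructor <;> intro h <;> linarith

end CIS2019

open CIS2019

/-- **Conrey–Iwaniec–Soundararajan 2019, Theorem 1** (the twisted second moment of Dirichlet
`L`-functions of even primitive characters, averaged over ALL moduli `q ∈ [Q, 2Q]` with a smooth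
weight `W(q/Q)`, twisted by `χ(h)χ̄(k)`, equals the diagonal-plus-dual main term
`Σ_{(q,hk)=1} W(q/Q)(Σ♭1)[(q/π)^{(α+β)/2}Γ(¼+α/2)Γ(¼+β/2)(h,k)^{1+α+β}/(h^{½+β}k^{½+α})ζ_q(1+α+β) + …]`
up to remainders `𝓔_{h,k}` whose bilinear average against ANY coefficients `λ_h ≪ h^ε` of length
`Q^ϑ` is `O(Q^{2−(1−ϑ)/2+ε})`, for every `ϑ < 1`, uniformly in shifts `α, β ≪ 1/log Q`).
Quantifier rendering (constants fixed first, then `K, Q₀`), the finite `q`-range, `χ̄ = χ⁻¹` and the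
restriction `α + β ≠ 0` (removable singularity of the main term) as explained in the module
docstring. NAMED FACT (theorem in print), not proved here.
[cite: ConreyIwaniecSoundararajan2019MeanSquare, Theorem 1] -/
def conreyIwaniecSoundararajan2019_theorem1 : Prop :=
  ∀ W : ℝ → ℝ, ContDiff ℝ ∞ W → tsupport W ⊆ Set.Icc (1 : ℝ) 2 →
    ∀ ϑ : ℝ, 0 < ϑ → ϑ < 1 →
      ∀ C₁ : ℝ, ∀ C : ℝ → ℝ, ∀ ε : ℝ, 0 < ε →
        ∃ K : ℝ, ∃ Q₀ : ℝ, ∀ Q : ℝ, Q₀ ≤ Q →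
          ∀ coef : ℕ → ℂ, BPRZ2020.DivisorBounded C coef →
            ∀ α β : ℂ, ‖α‖ ≤ C₁ / Real.log Q → ‖β‖ ≤ C₁ / Real.log Q → α + β ≠ 0 →
              ‖remainderForm W Q α β ⌊Q ^ ϑ⌋₊ coef‖ ≤ K * Q ^ (savingExponent ϑ + ε)

/-! ### Bookkeeping (proved) -/

/-- Theorem 1 covers twists of length `Q^ϑ` for every `ϑ ∈ (1/2, 1)` — beyond the square root of the
conductor (the individual-modulus "`1/2`-barrier" of `buiPrattRoblesZaharescu2020_theorem11`) and up
to, but not including, the full length of the conductor; e.g. `ϑ = 99/100` with saving exponent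
`2 − 1/200`. [cite: ConreyIwaniecSoundararajan2019MeanSquare, Theorem 1 and §1 discussion] -/
theorem conreyIwaniecSoundararajan2019_theorem1.near_full_length
    (hT : conreyIwaniecSoundararajan2019_theorem1) (W : ℝ → ℝ) (hW : ContDiff ℝ ∞ W)
    (hsupp : tsupport W ⊆ Set.Icc (1 : ℝ) 2) (C₁ : ℝ) (C : ℝ → ℝ) {ε : ℝ} (hε : 0 < ε) :
    ∃ K : ℝ, ∃ Q₀ : ℝ, ∀ Q : ℝ, Q₀ ≤ Q →
      ∀ coef : ℕ → ℂ, BPRZ2020.DivisorBounded C coef →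
        ∀ α β : ℂ, ‖α‖ ≤ C₁ / Real.log Q → ‖β‖ ≤ C₁ / Real.log Q → α + β ≠ 0 →
          ‖remainderForm W Q α β ⌊Q ^ ((99 : ℝ) / 100)⌋₊ coef‖ ≤
            K * Q ^ (savingExponent (99 / 100) + ε) :=
  hT W hW hsupp (99 / 100) (by norm_num) (by norm_num) C₁ C ε hε

/-- The saving exponent at `ϑ = 99/100` is `2 − 1/200`.
[cite: ConreyIwaniecSoundararajan2019MeanSquare, Theorem 1] -/
theorem CIS2019.savingExponent_example : savingExponent (99 / 100) = 2 - 1 / 200 := by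
  norm_num [savingExponent]

end Literature.NumberTheory.LFunctions

end
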